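import Literature.NumberTheory.EllipticCurves.ShaRestrictionIndex
import Literature.NumberTheory.EllipticCurves.SelmerGroupCardinality
import HarnessLib

/-!
# Route `GenusKolyvaginAtTwo`, LINE 18 / LINE 19 (`plus_descent` on L_T `PowDvdShaCardAtTwoRT`,
# stmt-BirchSwinnertonDyer-23242; `regular_plus_descent` on L⁺_T `PowDvdShaCardAtTwoPosT`, stmt-23379),
# registered stub `stub_genusRestrictionDvd(Pos)`, FIRST BRICK:
# THE KERNEL OF `Ш(E/K) → Ш(E_L/L)` AT A QUADRATIC STEP HAS ORDER `≤ 2^{rank E(L)}` WHEN `E(L)[2] = 0`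

Seat `bsd-line-gk2-p3` g16 (cell `bsd-f1-sign2`), `--supports stmt-BirchSwinnertonDyer-23242` (helper; closes
nothing).  THEOREMS ONLY (no definition, no named fact, no `sorry`); BSD is not proved by any of this.

The stub `stub_genusRestrictionDvd` of the pen's LINE 18 skeleton asks `#Ш(E/ℚ)[2^∞] ∣ #Ш(E_K/K)[2^∞]` on the
genus habitat ("rigidity by squareness": the kernel of restriction has order `≤ 2`, both orders are squares).
This file supplies the KERNEL half in general form.  For an elliptic curve `E` over a number field `K` and a
quadratic Galois extension `L/K`, the kernel of `H¹(K, E) → H¹(L, E)` is inflated from `H¹(Gal(L/K), E(L))`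
(Kramer 1981, proof of Thm. 2: "the kernel of res is the image under inflation of `H¹(G, E^{(d)}(K))`";
Serre, *Galois Cohomology*, I.§2.4 / I.§5.8), and at index two a crossed homomorphism vanishing on
`Γ_L` IS its value `f(σ) ∈ E(L)` at the non-trivial coset, with `f(σ) + σ f(σ) = 0`; if `f(σ) ∈ 2E(L)` and
`E(L)[2] = 0` then `f` is principal.  Hence `#ker ≤ #(E(L)/2E(L)) = 2^{rank E(L)} · #E(L)[2] = 2^{rank E(L)}`.

* §1 `natCard_range_inflClass_le_of_index_two` — ABSTRACT INDEX-TWO INFLATION BOUND on the tree's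
  `Literature.NumberTheory.EllipticCurves.inflClass` / `cocyclesVanishingOn` (`ShaRestriction`): for an open
  normal subgroup `N ≤ G` with a coset generator `σ` (`∀ b, Xor (b σ ∈ N) (b ∈ N)`, Mathlib's
  `Subgroup.index_eq_two_iff`) and `S = M^N` without `2`-torsion, `#range(infl) ≤ #(S / 2S)`
  (`inflClass_eq_zero_of_apply_eq_two_smul`: `f(σ) = 2t`, `t ∈ S` ⟹ `[f] = 0`).
* §2 `natCard_localRestrictionKer_le_two_pow_mordellWeilRank` — for `L/K` Galois quadratic with `E(L)[2] = 0`: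
  `#ker(H¹(K, E) → H¹(L, E)) ≤ 2^{rank E(L)}` (§1 with `N = Γ_{L̃}`, `S = E(L̃) ≅ E(L)` via
  `IsNormalClosure.equiv`, Mordell–Weil and `natCard_quotient_range_zsmul_eq_pow_mul_card_torsionBy`);
  `natCard_ker_shaRestriction_le_two_pow_mordellWeilRank` — the same bound for the kernel of
  `Literature.NumberTheory.EllipticCurves.shaRestriction W L : Ш(E/K) → Ш(E_L/L)`.

References: [Kramer1981] proof of Thm. 2 (p. 134); [SerreGaloisCohomology1997] I.§2.4, I.§5.8;
[Darmon2004] Exercise 3.18; [SilvermanAEC2009] VIII.6.7, X.4.2, App. B.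
-/

set_option autoImplicit false
-- the Theorems namespace of this sub repeats the summit name by design (D-0017 nested layout)
set_option linter.dupNamespace false

noncomputable section

open scoped Classical

namespace Summit.BirchSwinnertonDyer.BirchSwinnertonDyer.Theorems.GenusExact.PlusDescent

open Literature.NumberTheory.EllipticCurves Literature.NumberTheory.GaloisRepresentations

universe u

/-! ## §1 The abstract index-two inflation bound -/

section IndexTwo

variable {G : Type u} [Group G] [TopologicalSpace G] [IsTopologicalGroup G]
variable {M : Type u} [AddCommGroup M] [DistribMulAction G M] [TopologicalSpace M]
  [DiscreteTopology M]
variable {N : Subgroup G} {σ : G}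

omit [TopologicalSpace G] [IsTopologicalGroup G] in
/-- A coset generator of an index-two subgroup lies outside it (`b := 1` in `Xor (b σ ∈ N) (b ∈ N)`).
[folklore] -/
theorem not_mem_of_xor_mul (hσ : ∀ b : G, Xor (b * σ ∈ N) (b ∈ N)) : σ ∉ N := by
  have h := hσ 1
  rw [one_mul] at h
  exact h.elim (fun h1 ↦ (h1.2 N.one_mem).elim) fun h2 ↦ h2.2

omit [TopologicalSpace G] [IsTopologicalGroup G] in
/-- The square of a coset generator of an index-two subgroup lies in the subgroup (`b := σ`). [folklore] -/
theorem mul_self_mem_of_xor_mul (hσ : ∀ b : G, Xor (b * σ ∈ N) (b ∈ N)) : σ * σ ∈ N :=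
  (hσ σ).elim (fun h ↦ h.1) fun h ↦ (not_mem_of_xor_mul hσ h.1).elim

omit [TopologicalSpace G] [IsTopologicalGroup G] in
/-- At index two every element outside `N` is `n σ` with `n ∈ N` (`n = g σ (σσ)⁻¹`). [folklore] -/
theorem exists_eq_mul_of_not_mem (hσ : ∀ b : G, Xor (b * σ ∈ N) (b ∈ N)) {g : G} (hg : g ∉ N) :
    ∃ n ∈ N, g = n * σ :=
  (hσ g).elim
    (fun h ↦ ⟨g * σ * (σ * σ)⁻¹, N.mul_mem h.1 (N.inv_mem (mul_self_mem_of_xor_mul hσ)), by group⟩)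
    fun h ↦ (hg h.1).elim

omit [TopologicalSpace G] [IsTopologicalGroup G] [TopologicalSpace M] [DiscreteTopology M] in
/-- For a crossed homomorphism `f` vanishing on `N` and a coset generator `σ` (`σ² ∈ N`):
`f σ + σ • f σ = f (σ σ) = 0`. Serre, *Galois Cohomology*, I.§5.8. [folklore] -/
theorem apply_add_smul_apply_eq_zero (hσ : ∀ b : G, Xor (b * σ ∈ N) (b ∈ N))
    (f : cocyclesVanishingOn M N) : f.1 σ + σ • f.1 σ = 0 := by
  have h := cocyclesVanishingOn.cocycle f σ σ
  rw [cocyclesVanishingOn.apply_of_mem f (mul_self_mem_of_xor_mul hσ)] at h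
  exact h.symm

omit [TopologicalSpace G] [IsTopologicalGroup G] [TopologicalSpace M] [DiscreteTopology M] in
/-- At index two a crossed homomorphism vanishing on the normal subgroup `N` is CONSTANT off `N`:
`f g = f σ` for `g ∉ N` (`g = n σ`, `f (n σ) = n • f σ = f σ`). Serre, *Galois Cohomology*, I.§5.8. [folklore] -/
theorem apply_eq_apply_of_not_mem [N.Normal] (hσ : ∀ b : G, Xor (b * σ ∈ N) (b ∈ N))
    (f : cocyclesVanishingOn M N) {g : G} (hg : g ∉ N) : f.1 g = f.1 σ := by
  obtain ⟨n, hn, rfl⟩ := exists_eq_mul_of_not_mem hσ hg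
  rw [cocyclesVanishingOn.apply_of_mem_mul f σ hn, cocyclesVanishingOn.smul_apply f σ hn]

variable {S : AddSubgroup M}

omit [TopologicalSpace G] [IsTopologicalGroup G] [TopologicalSpace M] [DiscreteTopology M] in
/-- The values of a crossed homomorphism vanishing on the normal subgroup `N` are `N`-invariant, i.e.
lie in `S = M^N`. Serre, *Galois Cohomology*, I.§5.8. [folklore] -/
theorem apply_mem_of_invariants [N.Normal] (hS : ∀ m : M, m ∈ S ↔ ∀ n ∈ N, n • m = m)
    (f : cocyclesVanishingOn M N) (g : G) : f.1 g ∈ S :=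
  (hS _).mpr fun _ hn ↦ cocyclesVanishingOn.smul_apply f g hn

omit [TopologicalSpace G] [IsTopologicalGroup G] [TopologicalSpace M] [DiscreteTopology M] in
/-- `S = M^N` is `G`-stable for `N` normal (`n g m = g (g⁻¹ n g) m`). [folklore] -/
theorem smul_mem_of_invariants [N.Normal] (hS : ∀ m : M, m ∈ S ↔ ∀ n ∈ N, n • m = m)
    {m : M} (hm : m ∈ S) (g : G) : g • m ∈ S :=
  (hS _).mpr fun n hn ↦ by
    rw [smul_smul, show n * g = g * (g⁻¹ * n * g) by group, mul_smul,
      (hS m).mp hm _ (Subgroup.Normal.conj_mem' inferInstance n hn g)]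

/-- **Index-two inflation: a cocycle whose value at `σ` is twice an invariant is principal.** For `N`
open normal with coset generator `σ`, `S = M^N` without `2`-torsion, and `f` a crossed homomorphism
vanishing on `N` with `f σ = 2 • t`, `t ∈ S`: from `f σ + σ f σ = 0` one gets `2 • (t + σ t) = 0`, so
`σ t = -t`, and then `f g = g • (-t) - (-t)` for every `g` (both sides vanish on `N` and equal `2t` on
`N σ`), i.e. `[f] = 0` in `H¹_cont(G, M)`. Serre, *Galois Cohomology*, I.§2.2 and I.§5.8. [folklore] -/
theorem inflClass_eq_zero_of_apply_eq_two_smul [N.Normal] (hN : IsOpen (N : Set G))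
    (hσ : ∀ b : G, Xor (b * σ ∈ N) (b ∈ N)) (hS : ∀ m : M, m ∈ S ↔ ∀ n ∈ N, n • m = m)
    (h2 : ∀ s ∈ S, 2 • s = 0 → s = 0) (f : cocyclesVanishingOn M N) {t : M} (ht : t ∈ S)
    (hft : f.1 σ = 2 • t) : inflClass M N hN f = 0 := by
  -- `σ • t = -t`
  have hσt : σ • t ∈ S := smul_mem_of_invariants hS ht σ
  have hsum : t + σ • t = 0 := by
    refine h2 _ (S.add_mem ht hσt) ?_
    rw [smul_add, ← smul_comm σ (2 : ℕ) t, ← hft]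
    exact apply_add_smul_apply_eq_zero hσ f
  have hσt' : σ • t = -t := eq_neg_of_add_eq_zero_right hsum
  rw [inflClass_apply, oneCocycleClass_eq_zero_iff]
  refine ⟨-t, fun g ↦ ?_⟩
  rw [discreteTopRep_ρ_apply, toContOneCocycle_apply, smul_neg, sub_neg_eq_add]
  by_cases hg : g ∈ N
  · rw [cocyclesVanishingOn.apply_of_mem f hg, (hS t).mp ht g hg, neg_add_cancel]
  · obtain ⟨n, hn, rfl⟩ := exists_eq_mul_of_not_mem hσ hg
    rw [cocyclesVanishingOn.apply_of_mem_mul f σ hn, cocyclesVanishingOn.smul_apply f σ hn, hft,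
      mul_smul, hσt', smul_neg, neg_neg, (hS t).mp ht n hn, two_nsmul]

/-- **THE INDEX-TWO INFLATION BOUND.** Let `N ≤ G` be an open normal subgroup with a coset generator `σ`
(index two), `S = M^N` the `N`-invariants, assumed without `2`-torsion, and suppose `S / 2S` is finite.
Then the subgroup of `H¹_cont(G, M)` of classes inflated from crossed homomorphisms vanishing on `N` has
order at most `#(S / 2S)`: the evaluation `f ↦ f(σ) mod 2S` is additive and its kernel consists of
principal cocycles (`inflClass_eq_zero_of_apply_eq_two_smul`), so `range(infl)` is a quotient of a
subgroup of `S / 2S`.  (For `G = Γ_K ⊇ N = Γ_L`, `[L:K] = 2`: `#H¹(Gal(L/K), E(L)) ≤ #(E(L)/2E(L))`.)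
Serre, *Galois Cohomology*, I.§2.4 (cohomology of a cyclic group of order `2`) and I.§5.8.
[cite: SerreGaloisCohomology1997, I.§2.4 and I.§5.8] -/
theorem natCard_range_inflClass_le_of_index_two [N.Normal] (hN : IsOpen (N : Set G))
    (hσ : ∀ b : G, Xor (b * σ ∈ N) (b ∈ N)) (S : AddSubgroup M)
    (hS : ∀ m : M, m ∈ S ↔ ∀ n ∈ N, n • m = m) (h2 : ∀ s ∈ S, 2 • s = 0 → s = 0)
    (hfin : Finite (S ⧸ (zsmulAddGroupHom (α := S) ((2 : ℕ) : ℤ)).range)) :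
    Nat.card (inflClass M N hN).range ≤
      Nat.card (S ⧸ (zsmulAddGroupHom (α := S) ((2 : ℕ) : ℤ)).range) := by
  set T : AddSubgroup S := (zsmulAddGroupHom (α := S) ((2 : ℕ) : ℤ)).range with hTdef
  -- evaluation at `σ`, with values in `S`, then in `S / 2S`
  let Φ : cocyclesVanishingOn M N →+ S :=
    { toFun := fun f ↦ ⟨f.1 σ, apply_mem_of_invariants hS f σ⟩
      map_zero' := rfl
      map_add' := fun _ _ ↦ rfl }
  let Ψ : cocyclesVanishingOn M N →+ S ⧸ T := (QuotientAddGroup.mk' T).comp Φ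
  have hker : Ψ.ker ≤ (inflClass M N hN).ker := by
    intro f hf
    rw [AddMonoidHom.mem_ker] at hf ⊢
    have hf' : (Φ f : S) ∈ T := (QuotientAddGroup.eq_zero_iff _).mp hf
    obtain ⟨s, hs⟩ := hf'
    refine inflClass_eq_zero_of_apply_eq_two_smul hN hσ hS h2 f (t := (s : M)) s.2 ?_
    have h := congrArg (fun x : S ↦ (x : M)) hs
    simp only [zsmulAddGroupHom_apply, natCast_zsmul, AddSubgroupClass.coe_nsmul] at h
    exact h.symm
  -- the induced map on the quotient and the count
  let ι : cocyclesVanishingOn M N ⧸ Ψ.ker →+ discreteH1 G M := QuotientAddGroup.lift Ψ.ker (inflClass M N hN) hker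
  haveI : Finite Ψ.range := inferInstance
  haveI : Finite (cocyclesVanishingOn M N ⧸ Ψ.ker) :=
    Finite.of_equiv _ (QuotientAddGroup.quotientKerEquivRange Ψ).symm.toEquiv
  have hsurj : Function.Surjective
      (fun q : cocyclesVanishingOn M N ⧸ Ψ.ker ↦ (⟨ι q, by
        induction q using QuotientAddGroup.induction_on with
        | H f => exact ⟨f, (QuotientAddGroup.lift_mk' Ψ.ker hker f).symm⟩⟩ : (inflClass M N hN).range)) := by
    rintro ⟨c, f, rfl⟩
    exact ⟨QuotientAddGroup.mk f, Subtype.ext (QuotientAddGroup.lift_mk' Ψ.ker hker f)⟩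
  calc Nat.card (inflClass M N hN).range
      ≤ Nat.card (cocyclesVanishingOn M N ⧸ Ψ.ker) := Nat.card_le_card_of_surjective _ hsurj
    _ = Nat.card Ψ.range := Nat.card_congr (QuotientAddGroup.quotientKerEquivRange Ψ).toEquiv
    _ ≤ Nat.card (S ⧸ T) := AddSubgroup.card_le_card_addGroup _

end IndexTwo

/-! ## §2 Quadratic steps of number fields: `#ker(H¹(K, E) → H¹(L, E)) ≤ 2^{rank E(L)}` -/

section Quadratic

open IntermediateField WeierstrassCurve

variable {K : Type u} [Field K] [NumberField K] (W : WeierstrassCurve K) [W.IsElliptic]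
variable (L : Type u) [Field L] [NumberField L] [Algebra K L]

omit [W.IsElliptic] [NumberField L] in
/-- **`E(L̃) = E(K̄)^{Γ_{L̃}}`**: a geometric point is fixed by `Γ_{L̃} = Gal(K̄/L̃)` iff it comes from the
Galois closure `L̃` of `L/K` in `K̄` (`⇐`: `Γ_{L̃}` fixes the coordinates; `⇒`: the tree's Galois descent
`mem_pointsOfGaloisClosure_of_forall_smul_eq`). Silverman, *AEC*, VIII.§1. [folklore] -/
theorem mem_pointsOfGaloisClosure_iff (P : geomPoints W) :
    P ∈ pointsOfGaloisClosure W L ↔ ∀ τ ∈ galSubgroupClosure (K := K) L, τ • P = P := by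
  refine ⟨?_, mem_pointsOfGaloisClosure_of_forall_smul_eq W L P⟩
  rintro ⟨Q, rfl⟩ τ hτ
  set Fv : galoisClosureIn (K := K) L →ₐ[K] AlgebraicClosure K := (galoisClosureIn (K := K) L).val
  change WeierstrassCurve.Affine.Point.map
    ((show AlgebraicClosure K ≃ₐ[K] AlgebraicClosure K from τ) : AlgebraicClosure K →ₐ[K] AlgebraicClosure K)
      (WeierstrassCurve.Affine.Point.map Fv Q) = WeierstrassCurve.Affine.Point.map Fv Q
  have hc : ((show AlgebraicClosure K ≃ₐ[K] AlgebraicClosure K from τ) :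
      AlgebraicClosure K →ₐ[K] AlgebraicClosure K).comp Fv = Fv := by
    ext x
    exact (IntermediateField.mem_fixingSubgroup_iff _ _).mp hτ x.1 x.2
  rw [WeierstrassCurve.Affine.Point.map_map, hc]

/-- **The kernel of restriction at a quadratic Galois step has order `≤ 2^{rank E(L)}` when
`E(L)[2] = 0`.** For an elliptic curve `E` over a number field `K` and a Galois extension `L/K` of degree
`2` with `E(L)[2] = 0`: `#ker(H¹(K, E) → H¹(L, E)) ≤ 2^{rank_ℤ E(L)}`.  Proof: the kernel is inflated from
crossed homomorphisms vanishing on `Γ_{L̃}` (`resKer_le_range_inflClass`; `L̃ ≅ L` the Galois closure in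
`K̄`, `[Γ_K : Γ_{L̃}] = [L : K] = 2`), the invariants are `E(L̃) ≅ E(L)` (Galois descent, Mordell–Weil), and
the index-two bound (§1) gives `≤ #(E(L)/2E(L)) = 2^{rank} · #E(L)[2] = 2^{rank}`
(`natCard_quotient_range_zsmul_eq_pow_mul_card_torsionBy`).  Kramer 1981, proof of Thm. 2 ("the kernel of
res is the image under inflation of `H¹(G, E^{(d)}(K))`"); Serre I.§2.4, I.§5.8.
[cite: Kramer1981, proof of Thm. 2] [cite: SerreGaloisCohomology1997, I.§2.4 Cor. to Prop. 9 and I.§5.8]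
[cite: SilvermanAEC2009, Thm. VIII.6.7] -/
theorem natCard_localRestrictionKer_le_two_pow_mordellWeilRank [IsGalois K L]
    (h2 : Module.finrank K L = 2)
    (hL2 : ∀ P : (W.baseChange L).toAffine.Point, 2 • P = 0 → P = 0) :
    Nat.card (W.localRestrictionKer L) ≤ 2 ^ (W.baseChange L).mordellWeilRank := by
  haveI : FiniteDimensional K L := Module.Finite.of_restrictScalars_finite ℚ K L
  haveI hEL : (W.baseChange L).IsElliptic := by rw [WeierstrassCurve.baseChange]; infer_instance
  haveI hELc : (W.baseChange (galoisClosureIn (K := K) L)).IsElliptic := by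
    rw [WeierstrassCurve.baseChange]; infer_instance
  -- the open normal subgroup `N = Γ_{L̃}` of index two and a coset generator `σ`
  set N : Subgroup (Field.absoluteGaloisGroup K) := galSubgroupClosure (K := K) L with hNdef
  have hidx : N.index = 2 := by rw [hNdef, index_galSubgroupClosure_eq_finrank_of_isGalois L, h2]
  obtain ⟨σ, hσ⟩ := Subgroup.index_eq_two_iff.mp hidx
  -- the invariants `S = E(L̃)`, isomorphic to `E(L)`
  set S : AddSubgroup (geomPoints W) := pointsOfGaloisClosure W L with hSdef
  have hS : ∀ m : geomPoints W, m ∈ S ↔ ∀ n ∈ N, n • m = m := mem_pointsOfGaloisClosure_iff W L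
  haveI : Normal K (AlgebraicClosure K) := IsAlgClosure.normal K (AlgebraicClosure K)
  haveI : Nonempty (L →ₐ[K] AlgebraicClosure K) := ⟨IsAlgClosed.lift⟩
  haveI : IsNormalClosure K L L := isNormalClosure_self K L
  haveI : IsNormalClosure K L (galoisClosureIn (K := K) L) := by
    unfold galoisClosureIn; infer_instance
  let e : L ≃ₐ[K] galoisClosureIn (K := K) L :=
    IsNormalClosure.equiv (F := K) (K := L) (L := L) (L' := galoisClosureIn (K := K) L)
  -- `E(L) → E(L̃) → S`, both steps bijective
  let m₁ : (W.baseChange L).toAffine.Point →+ (W.baseChange (galoisClosureIn (K := K) L)).toAffine.Point :=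
    WeierstrassCurve.Affine.Point.map (W' := W) (e : L →ₐ[K] galoisClosureIn (K := K) L)
  have hm₁ : Function.Bijective m₁ := by
    refine ⟨WeierstrassCurve.Affine.Point.map_injective _, fun Q ↦ ⟨WeierstrassCurve.Affine.Point.map
      (W' := W) (e.symm : galoisClosureIn (K := K) L →ₐ[K] L) Q, ?_⟩⟩
    change WeierstrassCurve.Affine.Point.map _ (WeierstrassCurve.Affine.Point.map _ Q) = Q
    rw [WeierstrassCurve.Affine.Point.map_map, AlgEquiv.comp_symm]
    cases Q <;> rfl
  let m₂ : (W.baseChange (galoisClosureIn (K := K) L)).toAffine.Point →+ geomPoints W :=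
    WeierstrassCurve.Affine.Point.map (W' := W)
      ((galoisClosureIn (K := K) L).val : galoisClosureIn (K := K) L →ₐ[K] AlgebraicClosure K)
  have hm₂ : Function.Injective m₂ := WeierstrassCurve.Affine.Point.map_injective _
  have hm₂S : m₂.range = S := rfl
  let eS : (W.baseChange L).toAffine.Point ≃+ S :=
    (AddEquiv.ofBijective m₁ hm₁).trans ((AddMonoidHom.ofInjective hm₂).trans
      (AddEquiv.addSubgroupCongr hm₂S))
  -- `S` has no `2`-torsion and is finitely generated of rank `rank E(L)`
  have h2S : ∀ s ∈ S, 2 • s = 0 → s = 0 := by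
    intro s hs h0
    obtain ⟨P, hP⟩ := eS.surjective ⟨s, hs⟩
    have hP2 : eS (2 • P) = 0 := by
      rw [map_nsmul, hP]
      exact Subtype.ext h0
    have hP0 : P = 0 := hL2 P ((map_eq_zero_iff eS eS.injective).mp hP2)
    have := congrArg (fun x : S ↦ (x : geomPoints W)) hP
    rw [hP0, map_zero] at this
    exact this.symm
  haveI : Module.Finite ℤ S := Module.Finite.iff_addGroup_fg.mpr (fg_pointsOfGaloisClosure W L)
  haveI : NeZero (2 : ℕ) := ⟨two_ne_zero⟩
  have hT : Nat.card (S ⧸ (zsmulAddGroupHom (α := S) ((2 : ℕ) : ℤ)).range) =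
      2 ^ (W.baseChange L).mordellWeilRank := by
    rw [natCard_quotient_range_zsmul_eq_pow_mul_card_torsionBy (A := S) 2]
    have htors : AddSubgroup.torsionBy S ((2 : ℕ) : ℤ) = ⊥ := by
      rw [eq_bot_iff]
      intro x hx
      rw [AddSubgroup.mem_bot]
      have hx' : 2 • x = 0 := (AddSubgroup.torsionBy.nsmul_iff).mp hx
      exact Subtype.ext (h2S x x.2 (by
        have := congrArg (fun y : S ↦ (y : geomPoints W)) hx'
        simpa only [AddSubgroupClass.coe_nsmul, ZeroMemClass.coe_zero] using this))
    rw [htors, AddSubgroup.card_bot, mul_one, WeierstrassCurve.mordellWeilRank,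
      ← eS.toIntLinearEquiv.finrank_eq]
  have hfinT : Finite (S ⧸ (zsmulAddGroupHom (α := S) ((2 : ℕ) : ℤ)).range) :=
    Nat.finite_of_card_ne_zero (by rw [hT]; exact pow_ne_zero _ two_ne_zero)
  -- the kernel is inflated; count
  have hle : W.localRestrictionKer L ≤ (inflClass (geomPoints W) N (isOpen_galSubgroupClosure L)).range :=
    resKer_le_range_inflClass (resGal (K := K) L) (pointsMap W L) (pointsMap_smul W L)
      (pointsMapOfEmb_bijective L W _) N (isOpen_galSubgroupClosure L) (galSubgroupClosure_le_range_resGal L)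
  haveI : Finite (inflClass (geomPoints W) N (isOpen_galSubgroupClosure L)).range :=
    finite_range_inflClass N (isOpen_galSubgroupClosure L) S (fg_pointsOfGaloisClosure W L)
      (mem_pointsOfGaloisClosure_of_forall_smul_eq W L)
  calc Nat.card (W.localRestrictionKer L)
      ≤ Nat.card (inflClass (geomPoints W) N (isOpen_galSubgroupClosure L)).range :=
        AddSubgroup.card_le_of_le hle
    _ ≤ Nat.card (S ⧸ (zsmulAddGroupHom (α := S) ((2 : ℕ) : ℤ)).range) :=
        natCard_range_inflClass_le_of_index_two (isOpen_galSubgroupClosure L) hσ S hS h2S hfinT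
    _ = 2 ^ (W.baseChange L).mordellWeilRank := hT

/-- **The kernel of `Ш(E/K) → Ш(E_L/L)` at a quadratic Galois step has order `≤ 2^{rank E(L)}` when
`E(L)[2] = 0`** (it injects into the kernel of `H¹(K, E) → H¹(L, E)`,
`natCard_localRestrictionKer_le_two_pow_mordellWeilRank`). Darmon 2004, Exercise 3.18 / §3.9 ("the natural
map `Ш(E/ℚ) → Ш(E/K)` induced by restriction has finite kernel"), Kramer 1981 proof of Thm. 2.
[cite: Kramer1981, proof of Thm. 2] [cite: Darmon2004, Exercise 3.18] -/
theorem natCard_ker_shaRestriction_le_two_pow_mordellWeilRank [IsGalois K L]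
    (h2 : Module.finrank K L = 2)
    (hL2 : ∀ P : (W.baseChange L).toAffine.Point, 2 • P = 0 → P = 0) :
    Nat.card (shaRestriction W L).ker ≤ 2 ^ (W.baseChange L).mordellWeilRank := by
  haveI : Finite (W.localRestrictionKer L) := (finite_localRestrictionKer_numberField W L).to_subtype
  refine le_trans (Nat.card_le_card_of_injective
    (fun c : (shaRestriction W L).ker ↦ (⟨((c : W.sha) : W.galH1),
      (mem_ker_resBaseChange_iff W L _).mp (congrArg Subtype.val ((AddMonoidHom.mem_ker).mp c.2))⟩ :
        W.localRestrictionKer L)) ?_) (natCard_localRestrictionKer_le_two_pow_mordellWeilRank W L h2 hL2)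
  intro c c' h
  rw [Subtype.ext_iff] at h
  dsimp only at h
  exact Subtype.ext (Subtype.ext h)

end Quadratic

end Summit.BirchSwinnertonDyer.BirchSwinnertonDyer.Theorems.GenusExact.PlusDescent

end
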